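import Summits.BirchSwinnertonDyer.BirchSwinnertonDyer.Theorems.SchneiderFreeAdditiveX3PoitouTateShaDualOfReadoutUnramified
import Summits.BirchSwinnertonDyer.BirchSwinnertonDyer.Theorems.SchneiderFreeAdditiveX3PoitouTateReciprocityEqualityHolds
import HarnessLib

/-!
# Poitou–Tate duality of `Ш¹(K, M^D)` and `Ш²(K, M)` — the named fact `poitouTate_sha_tateDual K` — HOLDS for EVERY number field

Cell `bsd-schneider-ideate`, seat `bsd-schneider-door-c4` (prover, generation 19).  PARTITION: board row B6 ∩ X3 ∩ sst-twist,
`r = 1`, of `Rank1Residual.partition` — CONTROL corner (crux `AnticycControlAdditiveK`, item stmt-BirchSwinnertonDyer-19295; facts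
binder `ControlFacts`, item 19538, conjunct (ii)).  bears_on: K1-door (r1, B6∩X3-sst) (route-BirchSwinnertonDyer-SchneiderFreeAdditiveX3
items 18969 → 19295, 19538); the same named fact is bsd-wall's PT2 (item 20462 `Theses.UniversalToricDescent.PoitouTateShaTateDualFact`,
K4 stub `stub_poitouTateShaRat`).

THE RESULT.  `poitouTate_sha_tateDual_holds (K) : Literature.NumberTheory.GaloisCohomology.poitouTate_sha_tateDual K` — for every
number field `K`, every `n ≥ 1` and every finite `n`-torsion discrete `Γ_K`-module `M`: `Ш¹(K, M^D)` and `Ш²(K, M)` are finite and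
there is a perfect pairing `Ш²(K, M) × Ш¹(K, M^D) → ℤ/n` (Milne *ADT* I Thm. 4.10 (a) / Harari Thm. 17.13 (b) / Tate 1962), as the
tree states it (`PoitouTateSha.lean`).  ONE LINE over the cell's road (2026-08-26…28):
`poitouTate_sha_tateDual_of_R4` (door-c4 g19: Milne's proof of I 4.10 (a) on door-c4's canonical presentation `0 → N₁ → P → M → 0`
with EVERY input a tree theorem — Tate duality for the idèle class formation `(Γ_K, C̄)` (door-c4 g10–g17, door-c6 g15), the idèle
projections and their assembly (R3) (door-c5 g17), `SelmerComplement` of the canonical invariant maps (door-c4 g18), the local–global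
input (A) at every `K` (bsd-line-chl-p2 g7 at totally complex `K`; door-c4 g19 `tateDual_localGlobal_real` in general), the
idèle-torus Hasse input (B) (door-c5 g18), the `Ш²`-readout `Ψ` (bsd-line-chl-p2 g6–g7, bsd-inputs-k4-p1)) fed with the (R4)
reciprocity-equality bridge `hR4_ideleProjection` (door-c5 g18: `hR4_ideleProjection_of_readoutUnramified` + `hRur_holds` =
Milne I Lemma 4.13, + `nat_bijective`, `exists_bidual_intertwining`).

HONEST FRAMING: an in-tree proof of a PUBLISHED theorem (Poitou–Tate duality (b), 1962/1966) that the tree had vendored as a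
cite-only named fact; it discharges that fact wherever it is taken as a hypothesis.  It is NOT a case of BSD and moves no
mark by itself («closes rung: none»; the K1-door leaf items 19295 / 19538 close in the sibling files
`…AnticycControlAdditiveK.lean` / `…ControlFacts.lean`).
References: [MilneADT2006] I Thm. 4.10 (a) (proof, p. 58), Lemma 4.13; [Harari2020] Thm. 17.13 (b); [Tate1963DualityICM] Thm. 3.1.
-/

noncomputable section

-- `Summit.<P>.<Sub>` repeats `BirchSwinnertonDyer` by the tree's layout convention (D-0017)
set_option linter.dupNamespace false

namespace Summit.BirchSwinnertonDyer.BirchSwinnertonDyer.Theorems.SchneiderFreeAdditiveX3.PoitouTateReduction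

open Literature.NumberTheory.GaloisCohomology

/-- **Poitou–Tate duality (b) — `Ш¹(K, M^D)` and `Ш²(K, M)` are finite and perfectly paired — for EVERY number field `K` and
every finite Galois module**: the tree's named fact `poitouTate_sha_tateDual K` DISCHARGED (`poitouTate_sha_tateDual_of_R4` fed
with door-c5 g18's bridge `hR4_ideleProjection`; every other input of Milne's proof is a tree theorem, see the module docstring).
A published theorem re-proved in the tree; not a case of BSD.
[cite: MilneADT2006, Ch. I, Thm. 4.10 (a) (proof, p. 58), Lemma 4.13][cite: Harari2020, Thm. 17.13 (b)][cite: Tate1963DualityICM, Thm. 3.1] -/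
theorem poitouTate_sha_tateDual_holds (K : Type) [Field K] [NumberField K] : poitouTate_sha_tateDual K :=
  poitouTate_sha_tateDual_of_R4 (K := K) fun n _ _ _ _ _ _ _ ρ₀ hM => hR4_ideleProjection n ρ₀ hM

end Summit.BirchSwinnertonDyer.BirchSwinnertonDyer.Theorems.SchneiderFreeAdditiveX3.PoitouTateReduction

end
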